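import Mathlib.Algebra.CharP.Lemmas
import Literature.NumberTheory.Transcendental.KirbyDerivationExtension
import HarnessLib

/-!
# Kirby 2010, Thm. 1.1: `ecl` satisfies Steinitz exchange — proofs

Trunk T-TRANSCEND (`Literature/NumberTheory/Transcendental`). This file DISCHARGES the named fact
`Literature.NumberTheory.Transcendental.Kirby2010_ecl_exchange K` of `EclPregeometry.lean`

> **Theorem 1.1** (J. Kirby, *Exponential algebraicity in exponential fields*, Bull. Lond. Math.
> Soc. 42 (2010) 879–890). For any (total or partial) exponential field `F`, the closure operator
> `ecl^F` is a pregeometry, and it always agrees with the pregeometry `cl^F` defined using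
> derivations.

in the form vendored there — Steinitz exchange for the tree's `ecl`
(`a ∈ ecl (C ∪ {b}) ∖ ecl C ⟹ b ∈ ecl (C ∪ {a})`; the closure-operator and finite-character
parts of "pregeometry", Lemma 3.3, are `EclClosureOperatorProofs.lean`) — for EVERY field `K` with
an E-ring structure: `Kirby2010_ecl_exchange_holds`.

## The proof

Kirby's proof (ibid. p. 11) is `ecl = cl` (Prop. 4.7, proved in `KirbyEDerivations.lean`, and
Prop. 7.1, whose proof occupies §§5–7) plus exchange for `cl` (Lemma 4.4, two lines). We follow it,
working throughout with derivations of the ambient field `K` that are exponential only on a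
prescribed tuple (`eDerOn C z̄`), which avoids Kirby's partial E-fields and the transfinite
Prop. 5.6:

* (**Positive characteristic.**) On a field of characteristic `p > 0` the exponential map is
  trivial (Kirby, p. 3: `(eˣ - 1)ᵖ = 0`), so `x` solves the Khovanskii system `e^X - 1 = 0` and
  `ecl C = K` for every `C`: exchange is vacuous (`ecl_eq_univ_of_charP`).
* (**Reduction**, characteristic `0`.) By Lemma 3.3 (`ecl` monotone and idempotent) we may replace
  `C` by `ecl C`, an `ecl`-closed E-subfield (`Kirby2010_ecl_isExpSubfield_holds`).
* (**Key theorem** `exists_eDerOn_apply_ne_zero`, Kirby's Prop. 7.1 for the partial E-subfields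
  `ℚ(C)(z̄, e^{z̄})` of `K`.) If `C` is `ecl`-closed and `z̄ ∈ Kᴺ` is `ℚ`-linearly independent
  modulo `C`, every non-trivial integer combination of `z̄` is moved by some derivation of `K`
  vanishing on `C` and exponential on `z̄`. Strong induction on `N` as in Kirby's proof of
  Prop. 7.1: with `E₀` the common kernel of all such derivations, split `z̄` modulo `E₀`
  (`exists_split_mod`) into integral relations `z̄' ⊆ E₀` (`s` of them) and an independent part
  `ā` (`r'` elements). If `r' = 0` then `z̄ ⊆ E₀`, all these derivations vanish on
  `L = ℚ(C)(z̄, e^{z̄})`, and the Khovanskii dichotomy (Lemma 4.8, `khovanskii_dichotomy`) yields a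
  Khovanskii system for `z̄` over `C`, i.e. `z₁ ∈ ecl C = C` — absurd ("`F₂ = F₁` … thus
  `a ∈ ecl(C)`"). If `r' ≥ 1`, the induction hypothesis gives a derivation `D'`, exponential on
  `z̄'`, moving our combination `y ∈ ℚ(C)(z̄', e^{z̄'}) =: L'` ("`a ∉ cl^{F₂}(C)`"); the extension
  `L' ⊆ L'(ā, e^{ā})` is strong (Cor. 5.2: Ax's theorem for finitely many of our derivations,
  `Ax1971.add_rank_le_trdeg`, and the base change `trdeg_adjoin_le_of_subset`), so by Thm. 6.3
  (`exists_derivation_extend_exp`, `KirbyDerivationExtension.lean`) a derivation agreeing with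
  `D'` on `L'` and exponential on `ā` exists on `L'(ā, e^{ā})`; extended to `K`
  (`Derivation.exists_extension_of_charZero`) it is exponential on all of `z̄` (the exponential
  locus of a derivation is a `ℚ`-subspace, `expLinear`) and moves `y` — absurd.
* (**Exchange**, `mem_ecl_insert_of_isEclClosed`.) Let `a ∈ ecl (C ∪ {b}) ∖ C` be witnessed by the
  Khovanskii system `f̄(x̄, e^{x̄}) = 0` over `ℤ[C ∪ {b}]` with `x_k = a`. The key theorem gives a
  derivation `D` of `K` over `C`, exponential on `(b, x̄)`, with `D a ≠ 0`. The dichotomy over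
  `ℚ(C ∪ {a})` for `(b, x̄)` either produces a Khovanskii system — then `b ∈ ecl ℚ(C ∪ {a}) =
  ecl (C ∪ {a})` — or a derivation `D₀` over `ℚ(C ∪ {a})`, exponential on `(b, x̄)`, moving some
  coordinate. In the latter case `D₁ = (D₀ b) D - (D b) D₀` kills `ℤ[C ∪ {b}]`, so the chain rule
  through the Khovanskii system (Prop. 4.7, `derivation_apply_eq_zero_of_khovanskii`) gives
  `D₁ x̄ = 0`, whence `(D₀ b)(D a) = (D b)(D₀ a) = 0`, `D₀ b = 0`, and then `D₀ x̄ = 0` by the same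
  chain rule: `D₀` moves nothing — absurd. (This is Lemma 4.4's exchange for `cl`, run inside the
  finitely generated situation.)

## References

* J. Kirby, *Exponential algebraicity in exponential fields*, Bull. Lond. Math. Soc. 42 (2010),
  879–890, doi:10.1112/blms/bdq044, arXiv:0810.4285: Thm. 1.1, p. 3 (characteristic), Lemma 3.3,
  Lemma 4.4, Prop. 4.7, Lemma 4.8, Thm. 5.1, Cor. 5.2, Thm. 6.3, Prop. 7.1 and p. 11.
* J. Ax, *On Schanuel's conjectures*, Ann. of Math. 93 (1971), 252–268, Thm. 3.
-/

noncomputable section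

open Cardinal MvPolynomial
open Literature.ModelTheory.ExponentialFields

universe u

namespace Literature.NumberTheory.Transcendental

/-! ### Positive characteristic: the exponential is trivial and `ecl C = K` -/

section CharP

variable {K : Type*} [Field K] [ExponentialRing K]

/-- On a field of characteristic `p > 0` every exponential map is trivial: `(eˣ)ᵖ = e^{px} = 1`, so
`(eˣ - 1)ᵖ = 0` (Kirby 2010, p. 3: "This is the reason for the convention that E-domains and
E-fields are always of characteristic zero"). [cite: Kirby2010, §2 (p. 3)] -/
theorem exp_eq_one_of_charP {p : ℕ} [Fact p.Prime] [CharP K p] (x : K) :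
    ExponentialRing.exp x = 1 := by
  have h1 : ExponentialRing.exp x ^ p = 1 := by
    rw [← ExponentialRing.exp_nsmul, nsmul_eq_mul, CharP.cast_eq_zero, zero_mul,
      ExponentialRing.exp_zero]
  have h2 : (ExponentialRing.exp x - 1) ^ p = 0 := by
    rw [sub_pow_char, h1, one_pow, sub_self]
  exact sub_eq_zero.mp (pow_eq_zero_iff (Fact.out : p.Prime).ne_zero |>.mp h2)

/-- In characteristic `p > 0`, `ecl C = K` for every `C`: every `x` solves the one-unknown
Khovanskii system `e^X - 1 = 0` (coefficients `±1`, exponential Jacobian `e^x = 1 ≠ 0`).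
[cite: Kirby2010, §2 (p. 3) and Def. 3.1] -/
theorem ecl_eq_univ_of_charP {p : ℕ} [Fact p.Prime] [CharP K p] (C : Set K) :
    ecl C = Set.univ := by
  classical
  refine Set.eq_univ_of_forall fun x => ?_
  rw [Khovanskii.mem_ecl_iff]
  refine ⟨Unit, inferInstance, inferInstance, fun _ => x, fun _ => X (Sum.inr ()) - 1,
    Khovanskii.IsSol.single x _ (sub_mem (Khovanskii.X_mem_polyOver _ _) (one_mem _)) ?_ ?_,
    (), rfl⟩
  · simp [exp_eq_one_of_charP (p := p) x]
  · simp [Khovanskii.ePD, pderiv_X, exp_eq_one_of_charP (p := p) x]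

end CharP

/-! ### `ecl` of intermediate sets -/

section EclLemmas

variable {K : Type*} [Field K] [ExponentialRing K]

/-- If `S ⊆ T ⊆ ecl S` then `ecl T = ecl S` (`ecl` monotone and idempotent, Kirby Lemma 3.3).
[cite: Kirby2010, Lemma 3.3] -/
theorem ecl_eq_of_subset_of_subset_ecl {S T : Set K} (h₁ : S ⊆ T) (h₂ : T ⊆ ecl S) :
    ecl T = ecl S :=
  Set.Subset.antisymm ((ecl_mono h₂).trans (Khovanskii.ecl_ecl S).le) (ecl_mono h₁)

/-- `ecl (insert a (ecl C)) = ecl (insert a C)`. [cite: Kirby2010, Lemma 3.3] -/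
theorem ecl_insert_ecl (a : K) (C : Set K) : ecl (insert a (ecl C)) = ecl (insert a C) :=
  ecl_eq_of_subset_of_subset_ecl (Set.insert_subset_insert (subset_ecl C))
    (Set.insert_subset (subset_ecl _ (Set.mem_insert a C))
      ((ecl_mono (Set.subset_insert a C)).trans le_rfl))

variable [CharZero K]

/-- The subfield `ℚ(S)` generated by `S` lies inside `ecl S` (an E-subfield containing `S`,
Kirby Lemma 3.3). [cite: Kirby2010, Lemma 3.3] -/
theorem adjoin_rat_subset_ecl (S : Set K) :
    ((IntermediateField.adjoin ℚ S : IntermediateField ℚ K) : Set K) ⊆ ecl S := by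
  have hle : IntermediateField.adjoin ℚ S ≤
      (Khovanskii.eclSubfield S).toIntermediateField
        (fun q => SubfieldClass.ratCast_mem (Khovanskii.eclSubfield S) q) := by
    rw [IntermediateField.adjoin_le_iff]
    exact subset_ecl S
  intro x hx
  exact hle hx

/-- `ecl ℚ(S) = ecl S`. [cite: Kirby2010, Lemma 3.3] -/
theorem ecl_adjoin_rat (S : Set K) :
    ecl ((IntermediateField.adjoin ℚ S : IntermediateField ℚ K) : Set K) = ecl S :=
  ecl_eq_of_subset_of_subset_ecl (IntermediateField.subset_adjoin ℚ S) (adjoin_rat_subset_ecl S)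

end EclLemmas

/-! ### Derivations of `K` exponential on a tuple -/

section EDerOn

variable {K : Type*} [Field K] [ExponentialRing K]

/-- The `K`-space of derivations of `K` vanishing on `C` and **exponential on the tuple `z̄`**:
`D (e^{zᵢ}) = e^{zᵢ} D zᵢ` for all `i` (Kirby's `EDer(F/C)` for the partial exponential field
`F = K` with `exp` restricted to (the span of) `z̄`, Def. 4.1). [cite: Kirby2010, Def. 4.1] -/
def eDerOn (C : Set K) {ι : Type*} (z : ι → K) : Submodule K (Derivation ℤ K K) where
  carrier := {D | (∀ c ∈ C, D c = 0) ∧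
    ∀ i, D (ExponentialRing.exp (z i)) = ExponentialRing.exp (z i) * D (z i)}
  zero_mem' := ⟨fun c _ => by simp, fun i => by simp⟩
  add_mem' {D D'} hD hD' :=
    ⟨fun c hc => by rw [Derivation.add_apply, hD.1 c hc, hD'.1 c hc, add_zero],
      fun i => by rw [Derivation.add_apply, hD.2 i, hD'.2 i, Derivation.add_apply, mul_add]⟩
  smul_mem' t {D} hD :=
    ⟨fun c hc => by rw [Derivation.smul_apply, hD.1 c hc, smul_zero],
      fun i => by rw [Derivation.smul_apply, hD.2 i, Derivation.smul_apply, smul_eq_mul,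
        smul_eq_mul, mul_left_comm]⟩

/-- Membership in `eDerOn C z`. [cite: Kirby2010, Def. 4.1] -/
@[simp] theorem mem_eDerOn_iff {C : Set K} {ι : Type*} {z : ι → K} {D : Derivation ℤ K K} :
    D ∈ eDerOn C z ↔ (∀ c ∈ C, D c = 0) ∧
      ∀ i, D (ExponentialRing.exp (z i)) = ExponentialRing.exp (z i) * D (z i) :=
  Iff.rfl

/-! ### The exponential locus of a derivation is a `ℚ`-subspace -/

variable [CharZero K]

/-- If a derivation is exponential at `n • x` (`n ≥ 1`) then it is exponential at `x`:
`D(eⁿˣ) = D((eˣ)ⁿ) = n (eˣ)ⁿ⁻¹ D(eˣ)` and `eⁿˣ D(nx) = n (eˣ)ⁿ D x`; cancel `n (eˣ)ⁿ⁻¹`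
(characteristic zero, `eˣ ≠ 0`). [cite: Kirby2010, Lemma 4.8 (proof: "by `ℚ`-linearity")] -/
theorem derivation_exp_of_nsmul (D : Derivation ℤ K K) {x : K} {n : ℕ} (hn : n ≠ 0)
    (h : D (ExponentialRing.exp (n • x)) = ExponentialRing.exp (n • x) * D (n • x)) :
    D (ExponentialRing.exp x) = ExponentialRing.exp x * D x := by
  obtain ⟨m, rfl⟩ := Nat.exists_eq_succ_of_ne_zero hn
  have hE0 : ExponentialRing.exp x ≠ 0 := ExponentialRing.exp_ne_zero x
  rw [ExponentialRing.exp_nsmul, D.leibniz_pow, map_nsmul, Nat.succ_sub_one, pow_succ] at h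
  simp only [nsmul_eq_mul, smul_eq_mul] at h
  have h' : (((m.succ : ℕ) : K) * ExponentialRing.exp x ^ m) * D (ExponentialRing.exp x) =
      (((m.succ : ℕ) : K) * ExponentialRing.exp x ^ m) * (ExponentialRing.exp x * D x) := by
    linear_combination h
  exact mul_left_cancel₀
    (mul_ne_zero (Nat.cast_ne_zero.mpr (Nat.succ_ne_zero m)) (pow_ne_zero _ hE0)) h'

/-- The **exponential locus** `{x | D(eˣ) = eˣ D x}` of a derivation `D` of an exponential field
of characteristic zero is a `ℚ`-subspace (Kirby 2010, proof of Lemma 4.8: "All of the exponential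
relations `deᵇ = eᵇ db` follow from those for the `aᵢ` by `ℚ`-linearity").
[cite: Kirby2010, Lemma 4.8 (proof)] -/
def expLinear (D : Derivation ℤ K K) : Submodule ℚ K where
  carrier := {x | D (ExponentialRing.exp x) = ExponentialRing.exp x * D x}
  zero_mem' := by simp
  add_mem' {x y} hx hy := by
    simp only [Set.mem_setOf_eq] at hx hy ⊢
    rw [ExponentialRing.exp_add, Derivation.leibniz, hx, hy, map_add, smul_eq_mul, smul_eq_mul]
    ring
  smul_mem' q {x} hx := by
    simp only [Set.mem_setOf_eq] at hx ⊢
    -- first integer multiples (`e^{nx} = (eˣ)ⁿ`), then divide by the denominator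
    have hz : ∀ n : ℤ, D (ExponentialRing.exp (n • x)) =
        ExponentialRing.exp (n • x) * D (n • x) := by
      intro n
      have h := derivation_prod_zpow_of_exp D (fun _ : Fin 1 => x)
        (fun _ => ExponentialRing.exp x) (fun _ => ExponentialRing.exp_ne_zero x) (fun _ => hx)
        (fun _ => n)
      simp only [Fin.prod_univ_one, Fin.sum_univ_one] at h
      rw [ExponentialRing.exp_zsmul, zsmul_eq_mul, h]
    have hden : q.den ≠ 0 := q.den_nz
    apply derivation_exp_of_nsmul D hden
    have hq : q.den • (q • x) = q.num • x := by
      rw [← Nat.cast_smul_eq_nsmul ℚ, smul_smul, Rat.den_mul_eq_num, Int.cast_smul_eq_zsmul]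
    rw [hq]
    exact hz q.num

/-- Membership in `expLinear D`. [cite: Kirby2010, Lemma 4.8 (proof)] -/
@[simp] theorem mem_expLinear_iff {D : Derivation ℤ K K} {x : K} :
    x ∈ expLinear D ↔ D (ExponentialRing.exp x) = ExponentialRing.exp x * D x :=
  Iff.rfl

/-- Elements `c` with `D c = 0` and `D (eᶜ) = 0` (e.g. the elements of an E-subfield killed by
`D`) lie in the exponential locus. [cite: Kirby2010, Lemma 4.8 (proof)] -/
theorem mem_expLinear_of_apply_eq_zero {D : Derivation ℤ K K} {c : K} (hc : D c = 0)
    (hec : D (ExponentialRing.exp c) = 0) : c ∈ expLinear D := by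
  rw [mem_expLinear_iff, hc, hec, mul_zero]

end EDerOn

/-! ### The chain rule through a Khovanskii system (Prop. 4.7 for derivations exponential on `x̄`) -/

section ChainRule

variable {K : Type*} [Field K] [ExponentialRing K]

/-- **Kirby 2010, Prop. 4.7, for derivations exponential on the solution only.** If `x̄` solves
the Khovanskii system `fᵢ(x̄, e^{x̄}) = 0` (coefficients in `ℤ[S]`, non-vanishing exponential
Jacobian `J`) and `D` is a derivation of `K` vanishing on `S` with `D(e^{xⱼ}) = e^{xⱼ} D xⱼ` for
all `j`, then `J · (D xⱼ)ⱼ = 0` by the chain rule, so `D xⱼ = 0` for all `j`.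
[cite: Kirby2010, Prop. 4.7] -/
theorem derivation_apply_eq_zero_of_khovanskii {S : Set K} {n : ℕ} {x : Fin n → K}
    {f : Fin n → MvPolynomial (Fin n ⊕ Fin n) K}
    (hcoeff : ∀ i m, (f i).coeff m ∈ Subring.closure S)
    (heval : ∀ i, eval (Sum.elim x (ExponentialRing.exp ∘ x)) (f i) = 0)
    (hdet : (Matrix.of fun i j =>
      eval (Sum.elim x (ExponentialRing.exp ∘ x)) (expPDeriv j (f i))).det ≠ 0)
    (D : Derivation ℤ K K) (hDS : ∀ s ∈ S, D s = 0)
    (hDE : ∀ j, D (ExponentialRing.exp (x j)) = ExponentialRing.exp (x j) * D (x j)) (j : Fin n) :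
    D (x j) = 0 := by
  classical
  set R : Subring K := Subring.closure S
  have hR : ∀ s ∈ R, D s = 0 := fun s hs => derivation_eq_zero_of_mem_closure hDS hs
  -- lift the polynomials to `R`
  have hlift : ∀ i, ∃ g : MvPolynomial (Fin n ⊕ Fin n) R, map R.subtype g = f i := by
    intro i
    show f i ∈ Set.range (map R.subtype)
    rw [mem_range_map_iff_coeffs_subset]
    intro c hc
    obtain ⟨m, -, rfl⟩ := mem_coeffs_iff.mp (Finset.mem_coe.mp hc)
    exact ⟨⟨_, hcoeff i m⟩, rfl⟩
  choose g hg using hlift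
  set z : Fin n ⊕ Fin n → K := Sum.elim x (ExponentialRing.exp ∘ x) with hz
  -- the chain rule for each equation
  have hchain : ∀ i, ∑ j', eval z (expPDeriv j' (f i)) * D (x j') = 0 := by
    intro i
    have hmap : ∀ p : MvPolynomial (Fin n ⊕ Fin n) R,
        eval z (map R.subtype p) = aeval (R := R) (S₁ := K) z p :=
      fun p => by rw [eval_map, aeval_def]; rfl
    have h := derivation_mvPolynomial_aeval (derivationOfSubring R D hR) z (g i)
    rw [derivationOfSubring_apply, Fintype.sum_sum_type, ← hmap, hg, heval i, map_zero] at h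
    rw [h, ← Finset.sum_add_distrib]
    refine Finset.sum_congr rfl fun j' _ => ?_
    rw [derivationOfSubring_apply, derivationOfSubring_apply, smul_eq_mul, smul_eq_mul, ← hg,
      expPDeriv, pderiv_map, pderiv_map, map_add, map_mul, MvPolynomial.eval_X, hmap, hmap]
    have hj : D (z (Sum.inr j')) = ExponentialRing.exp (x j') * D (x j') := hDE j'
    rw [hj, show z (Sum.inl j') = x j' from rfl,
      show z (Sum.inr j') = ExponentialRing.exp (x j') from rfl]
    ring
  set J : Matrix (Fin n) (Fin n) K := Matrix.of fun i j' => eval z (expPDeriv j' (f i))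
  have hJ : J.mulVec (fun j' => D (x j')) = 0 := by
    ext i
    rw [Matrix.mulVec, Pi.zero_apply, ← hchain i]
    rfl
  have := Matrix.eq_zero_of_mulVec_eq_zero hdet hJ
  exact congr_fun this j

end ChainRule

/-! ### Tools: integral combinations, Khovanskii systems over subfields, extension to `K` -/

section Tools

variable {K : Type u} [Field K] [CharZero K] [ExponentialRing K]

omit [ExponentialRing K] in
/-- Integer combinations with `ℚ`-linearly independent coefficient rows of a tuple independent
modulo `V` are independent modulo `V`. [folklore] -/
theorem linearIndependent_mkQ_intComb {V : Submodule ℚ K} {N : ℕ} {z : Fin N → K}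
    (hz : LinearIndependent ℚ (V.mkQ ∘ z)) {s : ℕ} {w : Fin s → Fin N → ℤ}
    (hw : LinearIndependent ℚ (fun k i => (w k i : ℚ))) :
    LinearIndependent ℚ (V.mkQ ∘ fun k => ∑ i, (w k i : K) * z i) := by
  rw [Fintype.linearIndependent_iff]
  intro c hc
  have hc1 : ∑ i, (∑ k, c k * (w k i : ℚ)) • (V.mkQ ∘ z) i = 0 := by
    rw [← hc]
    simp only [Function.comp_apply, map_sum, Finset.smul_sum, Finset.sum_smul, mul_smul]
    rw [Finset.sum_comm]
    refine Finset.sum_congr rfl fun k _ => Finset.sum_congr rfl fun i _ => ?_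
    rw [← map_smul, ← map_smul, ← map_smul, Rat.smul_def (w k i : ℚ), Rat.cast_intCast]
  have hc2 := Fintype.linearIndependent_iff.mp hz _ hc1
  have hc3 : ∑ k, c k • (fun i => (w k i : ℚ)) = 0 := by
    funext i
    rw [Finset.sum_apply, Pi.zero_apply]
    simpa only [Pi.smul_apply, smul_eq_mul] using hc2 i
  exact Fintype.linearIndependent_iff.mp hw c hc3

/-- **A Khovanskii system over a subfield `F'` puts its solution in `ecl F'`.** If `(ū, e^{ū})`,
read inside an intermediate field `L ⊇ F'`, is a non-degenerate zero of `n` polynomials over `F'`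
for the exponential Jacobian, then every `uⱼ ∈ ecl F'` (the coefficients lie in the subring `F'`;
this is the conversion used in `card_le_relTrdeg_of_isEclClosed`). [cite: Kirby2010, Def. 3.2] -/
theorem mem_ecl_coe_of_khovanskii (F' : IntermediateField ℚ K) {n : ℕ} (u : Fin n → K)
    (L : IntermediateField F' K) (uL yL : Fin n → L) (huL : ∀ i, (uL i : K) = u i)
    (hyL : ∀ i, (yL i : K) = ExponentialRing.exp (u i))
    (g : Fin n → MvPolynomial (Fin n ⊕ Fin n) F')
    (hg0 : ∀ i, aeval (Sum.elim uL yL) (g i) = 0)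
    (hdet : (Matrix.of fun i j => aeval (Sum.elim uL yL) (Khovanskii.ePD j (g i))).det ≠ 0)
    (j : Fin n) : u j ∈ ecl (F' : Set K) := by
  classical
  set zL : Fin n ⊕ Fin n → L := Sum.elim uL yL with hzL
  have hkpt : Khovanskii.kpt u = algebraMap L K ∘ zL := by
    funext t
    rcases t with i | i
    · exact (huL i).symm
    · exact (hyL i).symm
  have heval : ∀ p : MvPolynomial (Fin n ⊕ Fin n) F',
      MvPolynomial.eval (Khovanskii.kpt u) (MvPolynomial.map (algebraMap F' K) p) =
        algebraMap L K (aeval zL p) := by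
    intro p
    rw [MvPolynomial.eval_map, ← MvPolynomial.aeval_def, hkpt, MvPolynomial.aeval_algebraMap_apply]
  set f : Fin n → MvPolynomial (Fin n ⊕ Fin n) K :=
    fun i => MvPolynomial.map (algebraMap F' K) (g i) with hf
  have hsol : Khovanskii.IsSol (F' : Set K) u f :=
    { coeff := fun i => Khovanskii.mem_polyOver_iff.mpr fun mo => by
        simp only [hf, MvPolynomial.coeff_map]
        exact Subring.subset_closure ((g i).coeff mo).2
      eval_eq := fun i => by
        simp only [hf]
        rw [heval, hg0 i, map_zero]
      det_ne := by
        have hJ : Khovanskii.kjac u f = (algebraMap L K).mapMatrix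
            (Matrix.of fun i j => aeval zL (Khovanskii.ePD j (g i))) := by
          ext i j'
          simp only [Khovanskii.kjac, Matrix.of_apply, RingHom.mapMatrix_apply, Matrix.map_apply,
            hf]
          rw [Khovanskii.ePD_map, heval]
        rw [hJ, ← RingHom.map_det, map_ne_zero]
        exact hdet }
  exact Khovanskii.mem_ecl_iff.mpr ⟨Fin n, inferInstance, inferInstance, u, f, hsol, j, rfl⟩

omit [ExponentialRing K] in
/-- A derivation of an intermediate field `L ⊆ K` (over any base) extends to a derivation of `K`
(`Derivation.exists_extension_of_charZero`, values composed into `K`). [folklore] -/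
theorem exists_derivation_extend_of_intermediateField {E : Type*} [Field E] [Algebra E K]
    (L : IntermediateField E K) (δ : Derivation ℤ L L) :
    ∃ D : Derivation ℤ K K, ∀ x : L, D x = δ x := by
  haveI : CharZero L := (algebraMap L K).charZero
  let dK : Derivation ℤ L K := (Algebra.linearMap L K).compDer δ
  obtain ⟨D, hD⟩ :=
    Derivation.exists_extension_of_charZero (R := ℤ) (F := L) (T := K) (M := K) dK
  exact ⟨D, fun x => hD x⟩

omit [ExponentialRing K] in
/-- An `F'`-derivation of an intermediate field `L` of `K/F'` extends to a derivation of `K`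
vanishing on `F'`. [folklore] -/
theorem exists_derivation_extend_of_intermediateField' (F' : IntermediateField ℚ K)
    (L : IntermediateField F' K) (D : Derivation F' L L) :
    ∃ D' : Derivation ℤ K K, (∀ c : F', D' c = 0) ∧ ∀ x : L, D' x = D x := by
  obtain ⟨D', hD'⟩ := exists_derivation_extend_of_intermediateField L (D.restrictScalars ℤ)
  refine ⟨D', fun c => ?_, fun x => hD' x⟩
  have h := hD' (algebraMap F' L c)
  rw [show ((c : K)) = ((algebraMap F' L c : L) : K) from rfl, h, Derivation.restrictScalars_apply,
    D.map_algebraMap]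
  rfl

end Tools

/-! ### Strongness of `ℚ(C)(z̄', e^{z̄'}) ⊆ ℚ(C)(z̄', e^{z̄'})(ā, e^{ā})` (Kirby Cor. 5.2) -/

section Key

variable {K : Type u} [Field K] [CharZero K] [ExponentialRing K]

/-- **Kirby 2010, Cor. 5.2, for the derivations `eDerOn C z̄`.** Let `C` be `ecl`-closed, let the
`z'ₖ` and `e^{z'ₖ}` be killed by every derivation of `eDerOn C z̄`, and let `ā` be exponential for
these derivations and integrally independent modulo their common kernel (no non-trivial
`Σ pₗ aₗ` is killed by all of them). Then for every integer matrix `w₁` with `ℚ`-linearly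
independent rows, with `bₖ = Σₗ w₁ₖₗ aₗ`: `s₁ ≤ trdeg_{L'} L'(b̄, e^{b̄})`, `L' = ℚ(C)(z̄', e^{z̄'})`
(Ax's theorem `Ax1971.add_rank_le_trdeg` for finitely many of the derivations detecting the
independence of `b̄`, `exists_finite_family_isQLinearIndependentMod`, whose constants contain `L'`;
then the base change `trdeg_adjoin_le_of_subset`). [cite: Kirby2010, Cor. 5.2] -/
theorem card_le_trdeg_of_eDerOn {C : Set K} (hC : IsEclClosed C) {N : ℕ} (z : Fin N → K)
    {s : ℕ} (z' : Fin s → K) (hz'N : ∀ k, ∀ D ∈ eDerOn C z, D (z' k) = 0)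
    (hz'E : ∀ k, ∀ D ∈ eDerOn C z, D (ExponentialRing.exp (z' k)) = 0)
    {r' : ℕ} (a : Fin r' → K)
    (haE : ∀ l, ∀ D ∈ eDerOn C z,
      D (ExponentialRing.exp (a l)) = ExponentialRing.exp (a l) * D (a l))
    (hindep : ∀ p : Fin r' → ℤ, (∀ D ∈ eDerOn C z, D (∑ l, (p l : K) * a l) = 0) → p = 0)
    {s₁ : ℕ} (w₁ : Fin s₁ → Fin r' → ℤ) (hli₁ : LinearIndependent ℚ (fun k i => (w₁ k i : ℚ))) :
    (s₁ : Cardinal) ≤ Algebra.trdeg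
      (IntermediateField.adjoin (IntermediateField.adjoin ℚ C)
        (Set.range z' ∪ Set.range (ExponentialRing.exp ∘ z')))
      (IntermediateField.adjoin (IntermediateField.adjoin (IntermediateField.adjoin ℚ C)
        (Set.range z' ∪ Set.range (ExponentialRing.exp ∘ z')))
        (Set.range (fun k => ∑ l, (w₁ k l : K) * a l) ∪
          Set.range (fun k => ExponentialRing.exp (∑ l, (w₁ k l : K) * a l)))) := by
  classical
  set F : IntermediateField ℚ K := IntermediateField.adjoin ℚ C with hF
  have hFC : ∀ c : F, (c : K) ∈ C := fun c => adjoin_rat_le_of_isEclClosed hC c.2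
  set L' : IntermediateField F K :=
    IntermediateField.adjoin F (Set.range z' ∪ Set.range (ExponentialRing.exp ∘ z')) with hL'
  set b₁ : Fin s₁ → K := fun k => ∑ l, (w₁ k l : K) * a l with hb₁
  -- `b̄` is integrally independent modulo the common kernel
  have hb₁ind : ∀ p : Fin s₁ → ℤ,
      (∀ D ∈ (eDerOn C z : Set (Derivation ℤ K K)), D (∑ k, (p k : K) * b₁ k) = 0) → p = 0 := by
    intro p hp
    set P : Fin r' → ℤ := fun l => ∑ k, p k * w₁ k l with hP
    have hsum : (∑ k, (p k : K) * b₁ k) = ∑ l, (P l : K) * a l := by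
      simp only [hb₁, hP, Finset.mul_sum, Int.cast_sum, Int.cast_mul, Finset.sum_mul]
      rw [Finset.sum_comm]
      exact Finset.sum_congr rfl fun l _ => Finset.sum_congr rfl fun k _ => by ring
    have hP0 : P = 0 := hindep P fun D hD => by rw [← hsum]; exact hp D hD
    have hrow : ∑ k, ((p k : ℚ)) • (fun i => (w₁ k i : ℚ)) = 0 := by
      funext l
      have h := congr_fun hP0 l
      rw [Pi.zero_apply, hP] at h
      have h' : (∑ k, (p k : ℚ) * (w₁ k l : ℚ)) = 0 := by exact_mod_cast h
      rw [Finset.sum_apply, Pi.zero_apply]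
      simpa only [Pi.smul_apply, smul_eq_mul] using h'
    have h := Fintype.linearIndependent_iff.mp hli₁ _ hrow
    funext k
    exact_mod_cast h k
  obtain ⟨m₁, Df, hDf, hindf⟩ :=
    exists_finite_family_isQLinearIndependentMod (eDerOn C z : Set (Derivation ℤ K K)) hb₁ind
  -- the pairs `(bₖ, e^{bₖ})` are exponential for the `Df j`
  have hexpb : ∀ j k, Df j (ExponentialRing.exp (b₁ k)) =
      ExponentialRing.exp (b₁ k) * Df j (b₁ k) := fun j k => by
    have h := derivation_prod_zpow_of_exp (Df j) a (ExponentialRing.exp ∘ a)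
      (fun l => ExponentialRing.exp_ne_zero _) (fun l => haE l _ (hDf j)) (w₁ k)
    simp only [Function.comp_apply] at h
    rw [hb₁]
    dsimp only
    rw [exp_sum_intCast_mul]
    exact h
  -- Ax's theorem, rank term dropped
  have hAx := Ax1971.add_rank_le_trdeg Df b₁ (ExponentialRing.exp ∘ b₁)
    (fun k => ExponentialRing.exp_ne_zero _) (fun j k => hexpb j k) hindf
  have hAx' : (s₁ : Cardinal) ≤ Algebra.trdeg (Transcendental.constantSubring Df)
      (Algebra.adjoin (Transcendental.constantSubring Df)
        (Set.range b₁ ∪ Set.range (ExponentialRing.exp ∘ b₁))) :=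
    le_trans (by exact_mod_cast Nat.le_add_right s₁ _) hAx
  -- `L'` lies in the constants of the `Df j`
  have hL'k : ((L' : IntermediateField F K) : Set K) ⊆
      (Transcendental.constantSubring Df : Subring K) := by
    intro x hx j
    refine derivation_eq_zero_on_adjoin (F := F) (Df j) (fun c => (hDf j).1 c (hFC c)) ?_ hx
    rintro t (⟨k, rfl⟩ | ⟨k, rfl⟩)
    · exact hz'N k _ (hDf j)
    · exact hz'E k _ (hDf j)
  exact hAx'.trans (trdeg_adjoin_le_of_subset (Transcendental.constantSubring Df) L' hL'k
    (Set.range b₁ ∪ Set.range (ExponentialRing.exp ∘ b₁)))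

omit [CharZero K] [ExponentialRing K] in
/-- Transcendence degrees of fields generated inside an intermediate field `M` can be read in `K`.
[folklore] -/
theorem trdeg_adjoin_eq_trdeg_adjoin_image {E : Type u} [Field E] [Algebra E K]
    (M : IntermediateField E K) (T : Set M) :
    Algebra.trdeg E (IntermediateField.adjoin E T) =
      Algebra.trdeg E (IntermediateField.adjoin E (Subtype.val '' T)) := by
  rw [(IntermediateField.liftAlgEquiv (IntermediateField.adjoin E T)).trdeg_eq,
    IntermediateField.lift_adjoin]

/-! ### Thm. 6.3 applied: a derivation of `K` through `L'(ā, e^{ā})` -/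

/-- **Kirby's extension step, assembled in `K`.** Let `L' ⊆ K` be a subfield, `ā ∈ K^{r'}` with
`(L', ā, e^{ā})` strong, and `D'` a derivation of `K` moving some `y ∈ L'`. Then there is a
derivation `DK` of `K` which (i) kills every `x ∈ L'` killed by `D'`, (ii) is exponential at every
`x ∈ L'` (with `eˣ ∈ L'`) at which `D'` is exponential, (iii) is exponential on `ā`, and (iv) moves
`y`. Construction (Kirby 2010, Thm. 6.3 and proof of Prop. 7.1): project `D'|_{Λ}`,
`Λ = L'(ā, e^{ā})`, to a derivation `δ' = π ∘ D'` of `Λ` with `δ' y = 1`; correct it on `Λ` to a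
derivation exponential on `ā` agreeing with `δ'` on `L'` (`exists_derivation_extend_exp`); extend
to `K` (`Derivation.exists_extension_of_charZero`). [cite: Kirby2010, Thm. 6.3] -/
theorem exists_derivation_through_adjoin {F : Type u} [Field F] [Algebra F K]
    (L' : IntermediateField F K) {r' : ℕ} (a : Fin r' → K)
    (hstrong : ∀ (s₁ : ℕ) (w₁ : Fin s₁ → Fin r' → ℤ),
      LinearIndependent ℚ (fun k i => (w₁ k i : ℚ)) →
        (s₁ : Cardinal) ≤ Algebra.trdeg L' (IntermediateField.adjoin L'
          (Set.range (fun k => ∑ l, (w₁ k l : K) * a l) ∪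
            Set.range (fun k => ExponentialRing.exp (∑ l, (w₁ k l : K) * a l)))))
    (D' : Derivation ℤ K K) {y : K} (hyL' : y ∈ L') (hD'y : D' y ≠ 0) :
    ∃ DK : Derivation ℤ K K,
      (∀ x : K, x ∈ L' → D' x = 0 → DK x = 0) ∧
      (∀ x : K, x ∈ L' → ExponentialRing.exp x ∈ L' →
        D' (ExponentialRing.exp x) = ExponentialRing.exp x * D' x →
          DK (ExponentialRing.exp x) = ExponentialRing.exp x * DK x) ∧
      (∀ l, DK (ExponentialRing.exp (a l)) = ExponentialRing.exp (a l) * DK (a l)) ∧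
      DK y ≠ 0 := by
  classical
  -- the field `Λ = L'(ā, e^{ā})`
  set SΛ : Set K := Set.range a ∪ Set.range (ExponentialRing.exp ∘ a) with hSΛ
  set L'' : IntermediateField L' K := IntermediateField.adjoin L' SΛ with hL''
  have haL'' : ∀ l, a l ∈ L'' := fun l => IntermediateField.subset_adjoin L' SΛ (Or.inl ⟨l, rfl⟩)
  have heaL'' : ∀ l, ExponentialRing.exp (a l) ∈ L'' := fun l =>
    IntermediateField.subset_adjoin L' SΛ (Or.inr ⟨l, rfl⟩)
  set aΛ : Fin r' → L'' := fun l => ⟨a l, haL'' l⟩ with haΛ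
  set eΛ : Fin r' → L'' := fun l => ⟨ExponentialRing.exp (a l), heaL'' l⟩ with heΛ'
  have heΛ : ∀ l, eΛ l ≠ 0 := fun l h =>
    ExponentialRing.exp_ne_zero (a l) (congrArg Subtype.val h)
  have htopΛ : IntermediateField.adjoin L' (Set.range aΛ ∪ Set.range eΛ) = ⊤ := by
    have h := IntermediateField.adjoin_preimage_val_eq_top (F := L') SΛ
    have hpre : Set.range aΛ ∪ Set.range eΛ = ((↑) : L'' → K) ⁻¹' SΛ := by
      ext t
      simp only [Set.mem_union, Set.mem_range, Set.mem_preimage, hSΛ, Function.comp_apply]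
      constructor
      · rintro (⟨i, rfl⟩ | ⟨i, rfl⟩)
        · exact Or.inl ⟨i, rfl⟩
        · exact Or.inr ⟨i, rfl⟩
      · rintro (⟨i, hi⟩ | ⟨i, hi⟩)
        · exact Or.inl ⟨i, Subtype.ext hi⟩
        · exact Or.inr ⟨i, Subtype.ext hi⟩
    rw [hpre]
    exact h
  haveI : CharZero L'' := (algebraMap L'' K).charZero
  -- strongness read inside `Λ`
  have hstrongΛ : ∀ (s₁ : ℕ) (w₁ : Fin s₁ → Fin r' → ℤ),
      LinearIndependent ℚ (fun k i => (w₁ k i : ℚ)) →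
        (s₁ : Cardinal) ≤ Algebra.trdeg L' (IntermediateField.adjoin L'
          (Set.range (fun k => ∑ l, (w₁ k l : L'') * aΛ l) ∪
            Set.range (fun k => ∏ l, eΛ l ^ w₁ k l))) := by
    intro s₁ w₁ hli₁
    rw [trdeg_adjoin_eq_trdeg_adjoin_image, Set.image_union, ← Set.range_comp, ← Set.range_comp]
    have e1 : (Subtype.val ∘ fun k => ∑ l, (w₁ k l : L'') * aΛ l) =
        fun k => ∑ l, (w₁ k l : K) * a l := by
      funext k
      change algebraMap L'' K (∑ l, (w₁ k l : L'') * aΛ l) = _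
      rw [map_sum]
      exact Finset.sum_congr rfl fun l _ => by rw [map_mul, map_intCast]; rfl
    have e2 : (Subtype.val ∘ fun k => ∏ l, eΛ l ^ w₁ k l) =
        fun k => ExponentialRing.exp (∑ l, (w₁ k l : K) * a l) := by
      funext k
      change algebraMap L'' K (∏ l, eΛ l ^ w₁ k l) = _
      rw [map_prod, exp_sum_intCast_mul]
      exact Finset.prod_congr rfl fun l _ => by rw [map_zpow₀]; rfl
    rw [e1, e2]
    exact hstrong s₁ w₁ hli₁
  -- the derivation `δ' = π ∘ D'|Λ` of `Λ` with `δ' y = 1`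
  obtain ⟨π, hπ⟩ : ∃ π : K →ₗ[L''] L'', π (D' y) = 1 := by
    set f₀ := (LinearEquiv.toSpanNonzeroSingleton L'' K (D' y) hD'y).symm with hf₀
    obtain ⟨π, hπ⟩ := LinearMap.exists_extend (f₀ : (L'' ∙ D' y) →ₗ[L''] L'')
    refine ⟨π, ?_⟩
    have h1 : π (D' y) =
        (π.comp (L'' ∙ D' y).subtype) ⟨D' y, Submodule.mem_span_singleton_self _⟩ := rfl
    have h2 : f₀ ⟨D' y, Submodule.mem_span_singleton_self _⟩ = 1 := by
      rw [hf₀, LinearEquiv.symm_apply_eq, LinearEquiv.toSpanNonzeroSingleton_one]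
    rw [h1, hπ, LinearEquiv.coe_coe, h2]
  set δ' : Derivation ℤ L'' L'' := π.compDer (D'.compAlgebraMap L'') with hδ'
  -- Thm. 6.3 on `Λ`, then extension to `K`
  obtain ⟨δ, hδL', hδE⟩ := exists_derivation_extend_exp aΛ eΛ heΛ htopΛ hstrongΛ δ'
  obtain ⟨DK, hDK⟩ := exists_derivation_extend_of_intermediateField L'' δ
  have hDKL' : ∀ x : L', DK x = π (D' x) := fun x => by
    have h2 := congrArg (fun t : L'' => (t : K)) (hδL' x)
    calc DK x = DK ((algebraMap L' L'' x : L'') : K) := rfl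
      _ = δ (algebraMap L' L'' x) := hDK _
      _ = δ' (algebraMap L' L'' x) := h2
      _ = π (D' x) := rfl
  have hsmulK : ∀ (t : L'') (v : K), t • v = (t : K) * v := fun t v => rfl
  refine ⟨DK, fun x hx hDx => ?_, fun x hx hex hDex => ?_, fun l => ?_, ?_⟩
  · -- (i)
    have h := hDKL' ⟨x, hx⟩
    dsimp only at h
    rw [h, hDx, map_zero]
    rfl
  · -- (ii)
    set eL : L' := ⟨ExponentialRing.exp x, hex⟩ with heL
    set xL : L' := ⟨x, hx⟩ with hxL
    have h1 : DK (ExponentialRing.exp x) = π (D' (ExponentialRing.exp x)) := hDKL' eL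
    have h2 : DK x = π (D' x) := hDKL' xL
    have h3 : D' (ExponentialRing.exp x) = (algebraMap L' L'' eL) • D' x := by
      rw [hDex, hsmulK]
      rfl
    rw [h1, h2, h3, map_smul, smul_eq_mul]
    push_cast
    rfl
  · -- (iii)
    have h3 := congrArg (fun t : L'' => (t : K)) (hδE l)
    have h2 : (δ (aΛ l) : K) = DK (a l) := (hDK (aΛ l)).symm
    calc DK (ExponentialRing.exp (a l)) = DK ((eΛ l : L'') : K) := rfl
      _ = δ (eΛ l) := hDK _
      _ = (eΛ l : K) * (δ (aΛ l) : K) := by rw [h3, MulMemClass.coe_mul]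
      _ = ExponentialRing.exp (a l) * DK (a l) := by rw [h2]
  · -- (iv)
    have h := hDKL' ⟨y, hyL'⟩
    dsimp only at h
    rw [h, hπ]
    simp

/-! ### The key theorem: non-trivial combinations of an independent tuple are moved -/

/-- **Key theorem (Kirby 2010, Prop. 7.1 for the partial E-subfields `ℚ(C)(z̄, e^{z̄})` of `K`).**
Let `C ⊆ K` be `ecl`-closed (characteristic zero) and `z : Fin N → K` `ℚ`-linearly independent
modulo `⟨C⟩_ℚ`. Then for every non-zero `q ∈ ℤᴺ` there is a derivation `D` of `K` vanishing on `C`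
and exponential on `z̄` (`D e^{zᵢ} = e^{zᵢ} D zᵢ`) with `D (Σ qⱼ zⱼ) ≠ 0`. (In Kirby's terms:
`cl(C) ∩ A(F) = C` for the partial E-field `F = ℚ(C)(ℚz̄, e^{ℚz̄})`; proof by induction on
`ldim_ℚ(A(F)/C)` through Lemma 4.8, Cor. 5.2 and Thm. 6.3 — see the module docstring.)
[cite: Kirby2010, Prop. 7.1] -/
theorem exists_eDerOn_apply_ne_zero {C : Set K} (hC : IsEclClosed C) :
    ∀ (N : ℕ) (z : Fin N → K), LinearIndependent ℚ ((Submodule.span ℚ C).mkQ ∘ z) →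
      ∀ q : Fin N → ℤ, q ≠ 0 → ∃ D ∈ eDerOn C z, D (∑ j, (q j : K) * z j) ≠ 0 := by
  intro N
  induction N using Nat.strong_induction_on with
  | _ N ih =>
  intro z hz q hq
  classical
  by_contra hcon
  push Not at hcon
  have hN : 0 < N := by
    rcases Nat.eq_zero_or_pos N with rfl | h
    · exact absurd (Subsingleton.elim q 0) hq
    · exact h
  -- `C` is an `ecl`-closed E-subfield containing `ℚ`
  have hCecl : ecl C = C := hC
  set F : IntermediateField ℚ K := IntermediateField.adjoin ℚ C with hF
  have hCF : ∀ c ∈ C, c ∈ F := fun c hc => IntermediateField.subset_adjoin ℚ C hc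
  -- the common kernel `E₀` of `eDerOn C z` as a `ℚ`-subspace, and the splitting of `z̄` modulo it
  set N₀ : Submodule ℚ K := ratKer (eDerOn C z : Set (Derivation ℤ K K)) with hN₀
  have hmemN₀ : ∀ x, x ∈ N₀ ↔ ∀ D ∈ eDerOn C z, D x = 0 := fun x => Iff.rfl
  obtain ⟨r', s, ι, w, hrs, hli_w, hwN, hindep, hgen, hspanV⟩ := exists_split_mod N₀ z
  rcases Nat.eq_zero_or_pos r' with hr0 | hr'
  · /- Case `r' = 0`: every `zⱼ` lies in `E₀`, so all our derivations vanish on `ℚ(C)(z̄, e^{z̄})`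
       and the Khovanskii dichotomy puts `z₀` in `ecl C = C` -/
    subst hr0
    have hzN : ∀ j, ∀ D ∈ eDerOn C z, D (z j) = 0 := fun j => by
      obtain ⟨f, hf⟩ := hgen j
      rw [Finset.univ_eq_empty, Finset.sum_empty, sub_zero] at hf
      exact (hmemN₀ _).mp hf
    set S : Set K := Set.range z ∪ Set.range (ExponentialRing.exp ∘ z) with hS
    set L : IntermediateField F K := IntermediateField.adjoin F S with hL
    have hxS : ∀ i, z i ∈ L := fun i => IntermediateField.subset_adjoin F S (Or.inl ⟨i, rfl⟩)
    have hyS : ∀ i, ExponentialRing.exp (z i) ∈ L := fun i =>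
      IntermediateField.subset_adjoin F S (Or.inr ⟨i, rfl⟩)
    set xL : Fin N → L := fun i => ⟨z i, hxS i⟩ with hxL
    set yL : Fin N → L := fun i => ⟨ExponentialRing.exp (z i), hyS i⟩ with hyL
    have htopL : IntermediateField.adjoin F (Set.range xL ∪ Set.range yL) = ⊤ := by
      have h := IntermediateField.adjoin_preimage_val_eq_top (F := F) S
      have hpre : Set.range xL ∪ Set.range yL = ((↑) : L → K) ⁻¹' S := by
        ext t
        simp only [Set.mem_union, Set.mem_range, Set.mem_preimage, hS, Function.comp_apply]
        constructor
        · rintro (⟨i, rfl⟩ | ⟨i, rfl⟩)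
          · exact Or.inl ⟨i, rfl⟩
          · exact Or.inr ⟨i, rfl⟩
        · rintro (⟨i, hi⟩ | ⟨i, hi⟩)
          · exact Or.inl ⟨i, Subtype.ext hi⟩
          · exact Or.inr ⟨i, Subtype.ext hi⟩
      rw [hpre]
      exact h
    rcases khovanskii_dichotomy xL yL htopL with ⟨g, hg0, hdet⟩ | ⟨D, hDE, j₀, hj₀⟩
    · have hmem : z ⟨0, hN⟩ ∈ ecl (F : Set K) :=
        mem_ecl_coe_of_khovanskii F z L xL yL (fun _ => rfl) (fun _ => rfl) g hg0 hdet ⟨0, hN⟩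
      rw [hF, ecl_adjoin_rat, hCecl] at hmem
      have h0 : ((Submodule.span ℚ C).mkQ ∘ z) ⟨0, hN⟩ = 0 := by
        simp only [Function.comp_apply, Submodule.mkQ_apply, Submodule.Quotient.mk_eq_zero]
        exact Submodule.subset_span hmem
      exact hz.ne_zero ⟨0, hN⟩ h0
    · obtain ⟨D', hD'F, hD'L⟩ := exists_derivation_extend_of_intermediateField' F L D
      have hD'mem : D' ∈ eDerOn C z := by
        refine ⟨fun c hc => hD'F ⟨c, hCF c hc⟩, fun i => ?_⟩
        have h1 := hD'L (yL i)
        have h2 := hD'L (xL i)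
        rw [hDE i] at h1
        change D' (ExponentialRing.exp (z i)) = ((yL i * D (xL i) : L) : K) at h1
        change D' (z i) = _ at h2
        rw [h1, h2]
        push_cast
        rfl
      have h := hzN j₀ D' hD'mem
      change D' ((xL j₀ : L) : K) = 0 at h
      rw [hD'L] at h
      exact hj₀ (by exact_mod_cast h)
  · /- Case `r' ≥ 1`: induction hypothesis for the integral relations `z̄' ⊆ E₀`, strongness of
       `ℚ(C)(z̄', e^{z̄'}) ⊆ ℚ(C)(z̄', e^{z̄'})(ā, e^{ā})` from Ax's theorem, extension by Thm. 6.3 -/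
    have hsN : s < N := by omega
    set y : K := ∑ j, (q j : K) * z j with hy
    have hyN : y ∈ N₀ := (hmemN₀ y).mpr hcon
    set z' : Fin s → K := fun k => ∑ i, (w k i : K) * z i with hz'
    have hwz' : ∀ k, (∑ i, ((w k i : ℚ)) • z i) = z' k := fun k =>
      Finset.sum_congr rfl fun i _ => by rw [Rat.smul_def, Rat.cast_intCast]
    have hz'N : ∀ k, ∀ D ∈ eDerOn C z, D (z' k) = 0 := fun k => by
      rw [← hmemN₀, ← hwz']
      exact hwN k
    have hz'E : ∀ k, ∀ D ∈ eDerOn C z, D (ExponentialRing.exp (z' k)) = 0 := fun k D hD => by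
      have hE := derivation_prod_zpow_of_exp D z (ExponentialRing.exp ∘ z)
        (fun i => ExponentialRing.exp_ne_zero _) (fun i => hD.2 i) (w k)
      have h0 : D (z' k) = 0 := hz'N k D hD
      simp only [Function.comp_apply] at hE
      rw [hz'] at h0 ⊢
      dsimp only at h0 ⊢
      rw [exp_sum_intCast_mul, hE, h0, mul_zero]
    -- `q` lies in the span of the rows of `w`: `M q = Σ μₖ wₖ`, so `M y = Σ μₖ z'ₖ`
    set qv : Fin N → ℚ := fun j => (q j : ℚ) with hqv
    have hqvy : (∑ j, qv j • z j) = y :=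
      Finset.sum_congr rfl fun j _ => by rw [hqv, Rat.smul_def, Rat.cast_intCast]
    have hqspan := hspanV qv (by rw [hqvy]; exact hyN)
    obtain ⟨g, hg⟩ := (Submodule.mem_span_range_iff_exists_fun ℚ).mp hqspan
    obtain ⟨M, hM, μ, hμ⟩ := exists_nat_mul_eq_intCast g
    have hMq : ∀ j, (M : ℚ) * qv j = ∑ k, (μ k : ℚ) * (w k j : ℚ) := fun j => by
      have h := congr_fun hg j
      simp only [Finset.sum_apply, Pi.smul_apply, smul_eq_mul] at h
      rw [← h, Finset.mul_sum]
      exact Finset.sum_congr rfl fun k _ => by rw [← mul_assoc, hμ]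
    have hMqZ : ∀ j, (M : ℤ) * q j = ∑ k, μ k * w k j := fun j => by
      have h := hMq j
      simp only [hqv] at h
      exact_mod_cast h
    have hMqK : ∀ j, (M : K) * (q j : K) = ∑ k, (μ k : K) * (w k j : K) := fun j => by
      have h := congrArg (fun t : ℤ => (t : K)) (hMqZ j)
      push_cast at h
      exact h
    have hMy : (M : K) * y = ∑ k, (μ k : K) * z' k := by
      rw [hy, Finset.mul_sum]
      simp_rw [← mul_assoc, hMqK, Finset.sum_mul, mul_assoc]
      rw [Finset.sum_comm]
      exact Finset.sum_congr rfl fun k _ => by rw [hz', Finset.mul_sum]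
    have hμ0 : μ ≠ 0 := by
      intro hμ0
      apply hq
      funext j
      have h := hMqZ j
      simp only [hμ0, Pi.zero_apply, zero_mul, Finset.sum_const_zero, mul_eq_zero,
        Nat.cast_eq_zero, hM, false_or] at h
      exact h
    -- induction hypothesis for `z̄'`
    have hz'ind : LinearIndependent ℚ ((Submodule.span ℚ C).mkQ ∘ z') :=
      linearIndependent_mkQ_intComb hz hli_w
    obtain ⟨D', hD'mem, hD'ne⟩ := ih s hsN z' hz'ind μ hμ0
    have hD'y : D' y ≠ 0 := by
      intro h0
      apply hD'ne
      rw [← hMy, Derivation.leibniz, h0, D'.map_natCast, smul_zero, smul_zero, add_zero]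
    -- the field `L' = ℚ(C)(z̄', e^{z̄'})`, which contains `C` and `y`
    set S' : Set K := Set.range z' ∪ Set.range (ExponentialRing.exp ∘ z') with hS'
    set L' : IntermediateField F K := IntermediateField.adjoin F S' with hL'
    have hz'L' : ∀ k, z' k ∈ L' := fun k => IntermediateField.subset_adjoin F S' (Or.inl ⟨k, rfl⟩)
    have hCL' : ∀ c ∈ C, c ∈ L' := fun c hc => L'.algebraMap_mem ⟨c, hCF c hc⟩
    have hyL' : y ∈ L' := by
      have hM' : (M : K) ≠ 0 := Nat.cast_ne_zero.mpr hM
      have : y = (M : K)⁻¹ * ∑ k, (μ k : K) * z' k := by rw [← hMy, inv_mul_cancel_left₀ hM']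
      rw [this]
      exact mul_mem (inv_mem (natCast_mem L' M))
        (sum_mem fun k _ => mul_mem (intCast_mem L' (μ k)) (hz'L' k))
    -- the independent part `ā`; strongness (Cor. 5.2) and the extension step (Thm. 6.3)
    set a : Fin r' → K := fun l => z (ι l) with ha
    have haE : ∀ l, ∀ D ∈ eDerOn C z,
        D (ExponentialRing.exp (a l)) = ExponentialRing.exp (a l) * D (a l) := fun l D hD => hD.2 (ι l)
    have hindepZ : ∀ p : Fin r' → ℤ, (∀ D ∈ eDerOn C z, D (∑ l, (p l : K) * a l) = 0) → p = 0 := by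
      intro p hp
      have hq' : (∑ l, ((p l : ℚ)) • z (ι l)) ∈ N₀ := by
        rw [hmemN₀]
        intro D hD
        have h := hp D hD
        rwa [show (∑ l, (p l : K) * a l) = ∑ l, ((p l : ℚ)) • z (ι l) from
          Finset.sum_congr rfl fun l _ => by rw [Rat.smul_def, Rat.cast_intCast]] at h
      have h := hindep _ hq'
      funext l
      have hl := congr_fun h l
      rw [Pi.zero_apply] at hl ⊢
      exact_mod_cast hl
    have hstrongK := fun (s₁ : ℕ) (w₁ : Fin s₁ → Fin r' → ℤ)
        (hli₁ : LinearIndependent ℚ (fun k i => (w₁ k i : ℚ))) =>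
      card_le_trdeg_of_eDerOn hC z z' hz'N hz'E a haE hindepZ w₁ hli₁
    obtain ⟨DK, hDK1, hDK2, hDK3, hDK4⟩ :=
      exists_derivation_through_adjoin L' a hstrongK D' hyL' hD'y
    -- `DK ∈ eDerOn C z`: it kills `C`, and its exponential locus contains `z̄'`, `ā`, hence `z̄`
    have hDKC : ∀ c ∈ C, DK c = 0 := fun c hc => hDK1 c (hCL' c hc) (hD'mem.1 c hc)
    have hz'locus : ∀ k, z' k ∈ expLinear DK := fun k =>
      hDK2 (z' k) (hz'L' k) (IntermediateField.subset_adjoin F S' (Or.inr ⟨k, rfl⟩)) (hD'mem.2 k)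
    have halocus : ∀ l, a l ∈ expLinear DK := fun l => hDK3 l
    have hTz : ∀ u : Fin N → ℚ, (∑ i, u i • z i) = Fintype.linearCombination ℚ z u := fun u =>
      (Fintype.linearCombination_apply ℚ z u).symm
    have hzlocus : ∀ j, z j ∈ expLinear DK := fun j => by
      obtain ⟨f, hf⟩ := hgen j
      set v : Fin N → ℚ := Pi.single j 1 - ∑ l, f l • Pi.single (ι l) 1 with hv
      have hTv : (∑ i, v i • z i) = z j - ∑ l, f l • a l := by
        rw [hTz, hv, map_sub, map_sum, Fintype.linearCombination_apply_single, one_smul]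
        simp only [map_smul, Fintype.linearCombination_apply_single, one_smul, ha]
      have hvspan := hspanV v (by rw [hTv]; exact hf)
      obtain ⟨g', hg'⟩ := (Submodule.mem_span_range_iff_exists_fun ℚ).mp hvspan
      have hsum : (∑ i, v i • z i) = ∑ k, g' k • z' k := by
        rw [hTz, ← hg', map_sum]
        refine Finset.sum_congr rfl fun k _ => ?_
        rw [map_smul, ← hTz, hwz']
      have hzj : z j = ∑ l, f l • a l + ∑ k, g' k • z' k := by
        rw [← hsum, hTv, add_sub_cancel]
      rw [hzj]
      exact add_mem (sum_mem fun l _ => Submodule.smul_mem _ _ (halocus l))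
        (sum_mem fun k _ => Submodule.smul_mem _ _ (hz'locus k))
    have hDKmem : DK ∈ eDerOn C z := ⟨hDKC, fun j => hzlocus j⟩
    exact hDK4 (hcon DK hDKmem)

end Key

/-! ### Exchange -/

section Exchange

variable {K : Type u} [Field K] [CharZero K] [ExponentialRing K]

/-- For an `ecl`-closed `C` (a subfield containing `ℚ`), `⟨C⟩_ℚ = C`. [cite: Kirby2010, Lemma 3.3] -/
theorem coe_span_rat_eq_of_isEclClosed {C : Set K} (hC : IsEclClosed C) :
    ((Submodule.span ℚ C : Submodule ℚ K) : Set K) = C := by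
  have hCecl : ecl C = C := hC
  let CQ : Submodule ℚ K :=
    { carrier := C
      add_mem' := fun {x y} hx hy => by
        rw [← hCecl] at hx hy ⊢
        exact Khovanskii.add_mem_ecl hx hy
      zero_mem' := by rw [← hCecl]; exact Khovanskii.zero_mem_ecl C
      smul_mem' := fun q {x} hx => by
        rw [← hCecl] at hx ⊢
        rw [Rat.smul_def]
        exact Khovanskii.mul_mem_ecl (SubfieldClass.ratCast_mem (Khovanskii.eclSubfield C) q) hx }
  refine Set.Subset.antisymm ?_ Submodule.subset_span
  have hle : Submodule.span ℚ C ≤ CQ := Submodule.span_le.mpr fun x hx => hx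
  intro x hx
  exact hle hx

-- Kirby's exchange argument (Lemma 4.4) inside `ℚ(C ∪ {a})(b, x̄, e^b, e^{x̄})`; the tuple `(b, x̄)`,
-- its independent part and the two dichotomy branches share a dozen abbreviations
set_option maxHeartbeats 400000 in
/-- **Exchange over an `ecl`-closed set** (Kirby 2010, Thm. 1.1 with Lemma 4.4, characteristic
zero). If `C` is `ecl`-closed, `a ∈ ecl (C ∪ {b})` and `a ∉ C`, then `b ∈ ecl (C ∪ {a})`. See the
module docstring: the key theorem provides a derivation `D` over `C`, exponential on `(b, x̄)`, with
`D a ≠ 0`; the Khovanskii dichotomy over `ℚ(C ∪ {a})` either exhibits `b ∈ ecl (C ∪ {a})` or a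
derivation `D₀` over `ℚ(C ∪ {a})` which, combined with `D` as `(D₀ b) D - (D b) D₀` and pushed
through the Khovanskii system of `a` (Prop. 4.7), must vanish on `(b, x̄)` — absurd.
[cite: Kirby2010, Thm. 1.1 and Lemma 4.4] -/
theorem mem_ecl_insert_of_isEclClosed {C : Set K} (hC : IsEclClosed C) {a b : K}
    (hab : a ∈ ecl (insert b C)) (ha : a ∉ C) : b ∈ ecl (insert a C) := by
  classical
  obtain ⟨n, x, f, ⟨k, hk⟩, hcoeff, heval, hdet⟩ := hab
  have hCecl : ecl C = C := hC
  have hexpC : ∀ c ∈ C, ExponentialRing.exp c ∈ C := fun c hc => by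
    rw [← hCecl] at hc ⊢
    exact Khovanskii.exp_mem_ecl hc
  -- the tuple `u = (b, x̄)`
  set u : Fin (n + 1) → K := Fin.cons b x with hu
  have hu0 : u 0 = b := rfl
  have hus : ∀ i, u i.succ = x i := fun i => by rw [hu, Fin.cons_succ]
  -- a maximal sub-tuple `z̄` of `u` independent modulo `C`
  set V : Submodule ℚ K := Submodule.span ℚ C with hV
  have hVC : (V : Set K) = C := coe_span_rat_eq_of_isEclClosed hC
  obtain ⟨κ, ι₀, hι₀, hspan, hli⟩ := exists_linearIndependent' ℚ (V.mkQ ∘ u)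
  haveI : Fintype κ := Fintype.ofInjective ι₀ hι₀
  set N := Fintype.card κ with hN
  set e := Fintype.equivFin κ with he
  set z : Fin N → K := fun j => u (ι₀ (e.symm j)) with hz
  have hzind : LinearIndependent ℚ (V.mkQ ∘ z) := by
    have : V.mkQ ∘ z = ((V.mkQ ∘ u) ∘ ι₀) ∘ e.symm := rfl
    rw [this]
    exact (linearIndependent_equiv e.symm).mpr hli
  -- every `uᵢ` is a `ℚ`-combination of `z̄` plus an element of `C`
  have hdecomp : ∀ i, ∃ (c : Fin N → ℚ) (c₀ : K), c₀ ∈ C ∧ u i = (∑ j, c j • z j) + c₀ := by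
    intro i
    have hmem : V.mkQ (u i) ∈ Submodule.span ℚ (Set.range ((V.mkQ ∘ u) ∘ ι₀)) := by
      rw [hspan]
      exact Submodule.subset_span ⟨i, rfl⟩
    obtain ⟨c, hc⟩ := (Submodule.mem_span_range_iff_exists_fun ℚ).mp hmem
    refine ⟨c ∘ e.symm, u i - ∑ j, (c ∘ e.symm) j • z j, ?_, by abel⟩
    have hmemV : u i - ∑ j, (c ∘ e.symm) j • z j ∈ V := by
      rw [← Submodule.Quotient.mk_eq_zero, ← Submodule.mkQ_apply, map_sub, map_sum, sub_eq_zero]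
      simp only [map_smul, Function.comp_apply] at hc ⊢
      rw [← hc]
      exact (Equiv.sum_comp e.symm (fun k' => c k' • V.mkQ (u (ι₀ k')))).symm
    have : u i - ∑ j, (c ∘ e.symm) j • z j ∈ (V : Set K) := hmemV
    rwa [hVC] at this
  -- `a = x_k` as an integer combination of `z̄` modulo `C`
  obtain ⟨c, c₀, hc₀, hac⟩ := hdecomp k.succ
  rw [hus k, hk] at hac
  obtain ⟨M, hM, μ, hμ⟩ := exists_nat_mul_eq_intCast c
  have hM' : (M : K) ≠ 0 := Nat.cast_ne_zero.mpr hM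
  have haM : (M : K) * a = (∑ j, (μ j : K) * z j) + (M : K) * c₀ := by
    rw [hac, mul_add, Finset.mul_sum]
    congr 1
    refine Finset.sum_congr rfl fun j _ => ?_
    rw [Rat.smul_def, ← mul_assoc]
    congr 1
    have h := hμ j
    have h' : ((M : ℚ) * c j : ℚ) = ((μ j : ℚ)) := h
    rw [← Rat.cast_natCast, ← Rat.cast_mul, h', Rat.cast_intCast]
  have hμ0 : μ ≠ 0 := by
    intro hμ0
    apply ha
    have h : (M : K) * a = (M : K) * c₀ := by
      rw [haM, hμ0]
      simp
    rw [mul_left_cancel₀ hM' h]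
    exact hc₀
  -- the key theorem: a derivation over `C`, exponential on `z̄`, moving `a`
  obtain ⟨D, hDmem, hDne⟩ := exists_eDerOn_apply_ne_zero hC N z hzind μ hμ0
  have hDa : D a ≠ 0 := by
    intro h0
    apply hDne
    have : (∑ j, (μ j : K) * z j) = (M : K) * a - (M : K) * c₀ := by rw [haM]; ring
    rw [this, map_sub, Derivation.leibniz, Derivation.leibniz, h0, hDmem.1 c₀ hc₀, D.map_natCast,
      smul_zero, smul_zero, smul_zero, zero_add, sub_self]
  -- `D` is exponential on every `uᵢ`
  have hlocus : ∀ i, u i ∈ expLinear D := fun i => by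
    obtain ⟨c', c₀', hc₀', hdec⟩ := hdecomp i
    rw [hdec]
    refine add_mem (sum_mem fun j _ => Submodule.smul_mem _ _ ?_)
      (mem_expLinear_of_apply_eq_zero (hDmem.1 c₀' hc₀') (hDmem.1 _ (hexpC c₀' hc₀')))
    exact hDmem.2 j
  have hDEu : ∀ i, D (ExponentialRing.exp (u i)) = ExponentialRing.exp (u i) * D (u i) :=
    fun i => hlocus i
  -- the Khovanskii dichotomy over `F' = ℚ(C ∪ {a})` for `(u, e^u)`
  set F' : IntermediateField ℚ K := IntermediateField.adjoin ℚ (insert a C) with hF'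
  set S : Set K := Set.range u ∪ Set.range (ExponentialRing.exp ∘ u) with hS
  set L : IntermediateField F' K := IntermediateField.adjoin F' S with hL
  have hxS : ∀ i, u i ∈ L := fun i => IntermediateField.subset_adjoin F' S (Or.inl ⟨i, rfl⟩)
  have hyS : ∀ i, ExponentialRing.exp (u i) ∈ L := fun i =>
    IntermediateField.subset_adjoin F' S (Or.inr ⟨i, rfl⟩)
  set uL : Fin (n + 1) → L := fun i => ⟨u i, hxS i⟩ with huL
  set wL : Fin (n + 1) → L := fun i => ⟨ExponentialRing.exp (u i), hyS i⟩ with hwL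
  have htopL : IntermediateField.adjoin F' (Set.range uL ∪ Set.range wL) = ⊤ := by
    have h := IntermediateField.adjoin_preimage_val_eq_top (F := F') S
    have hpre : Set.range uL ∪ Set.range wL = ((↑) : L → K) ⁻¹' S := by
      ext t
      simp only [Set.mem_union, Set.mem_range, Set.mem_preimage, hS, Function.comp_apply]
      constructor
      · rintro (⟨i, rfl⟩ | ⟨i, rfl⟩)
        · exact Or.inl ⟨i, rfl⟩
        · exact Or.inr ⟨i, rfl⟩
      · rintro (⟨i, hi⟩ | ⟨i, hi⟩)
        · exact Or.inl ⟨i, Subtype.ext hi⟩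
        · exact Or.inr ⟨i, Subtype.ext hi⟩
    rw [hpre]
    exact h
  rcases khovanskii_dichotomy uL wL htopL with ⟨g, hg0, hgdet⟩ | ⟨D₀, hD₀E, j₀, hj₀⟩
  · -- a Khovanskii system over `ℚ(C ∪ {a})`: `b = u₀ ∈ ecl ℚ(C ∪ {a}) = ecl (C ∪ {a})`
    have hmem := mem_ecl_coe_of_khovanskii F' u L uL wL (fun _ => rfl) (fun _ => rfl) g hg0 hgdet 0
    rw [hF', ecl_adjoin_rat] at hmem
    exact hmem
  · -- a derivation `D₀` over `ℚ(C ∪ {a})`, exponential on `u`, moving some `uⱼ`: impossible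
    exfalso
    obtain ⟨D₀', hD₀'F, hD₀'L⟩ := exists_derivation_extend_of_intermediateField' F' L D₀
    have hD₀'C : ∀ c ∈ C, D₀' c = 0 := fun c hc =>
      hD₀'F ⟨c, IntermediateField.subset_adjoin ℚ _ (Set.mem_insert_of_mem a hc)⟩
    have hD₀'a : D₀' a = 0 := hD₀'F ⟨a, IntermediateField.subset_adjoin ℚ _ (Set.mem_insert a C)⟩
    have hD₀'E : ∀ i, D₀' (ExponentialRing.exp (u i)) = ExponentialRing.exp (u i) * D₀' (u i) := by
      intro i
      have h1 := hD₀'L (wL i)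
      have h2 := hD₀'L (uL i)
      rw [hD₀E i] at h1
      change D₀' (ExponentialRing.exp (u i)) = ((wL i * D₀ (uL i) : L) : K) at h1
      change D₀' (u i) = _ at h2
      rw [h1, h2]
      push_cast
      rfl
    -- Lemma 4.4's combination `D₁ = (D₀ b) D - (D b) D₀` kills `ℤ[C ∪ {b}]`, hence `x̄` (Prop. 4.7)
    set D₁ : Derivation ℤ K K := (D₀' b) • D - (D b) • D₀' with hD₁
    have hD₁apply : ∀ t, D₁ t = D₀' b * D t - D b * D₀' t := fun t => by
      simp only [hD₁, Derivation.sub_apply, Derivation.smul_apply, smul_eq_mul]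
    have hD₁S : ∀ t ∈ insert b C, D₁ t = 0 := by
      rintro t (rfl | ht)
      · rw [hD₁apply]; ring
      · rw [hD₁apply, hDmem.1 t ht, hD₀'C t ht]; ring
    have hD₁E : ∀ j, D₁ (ExponentialRing.exp (x j)) = ExponentialRing.exp (x j) * D₁ (x j) := by
      intro j
      rw [hD₁apply, hD₁apply, ← hus j, hDEu, hD₀'E]
      ring
    have hD₁x := derivation_apply_eq_zero_of_khovanskii hcoeff heval hdet D₁ hD₁S hD₁E
    -- at the coordinate `x_k = a`: `(D₀ b)(D a) = 0`, so `D₀ b = 0`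
    have hb0 : D₀' b = 0 := by
      have h := hD₁x k
      rw [hD₁apply, hk, hD₀'a, mul_zero, sub_zero] at h
      exact (mul_eq_zero.mp h).resolve_right hDa
    -- hence `D₀` kills `ℤ[C ∪ {b}]` and `x̄`, i.e. all of `u`
    have hD₀'S : ∀ t ∈ insert b C, D₀' t = 0 := by
      rintro t (rfl | ht)
      · exact hb0
      · exact hD₀'C t ht
    have hD₀'x := derivation_apply_eq_zero_of_khovanskii hcoeff heval hdet D₀' hD₀'S
      (fun j => by rw [← hus j]; exact hD₀'E _)
    have hall : ∀ i, D₀' (u i) = 0 := fun i => by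
      refine Fin.cases ?_ (fun j => ?_) i
      · exact hb0
      · rw [hus]
        exact hD₀'x j
    have h := hall j₀
    change D₀' ((uL j₀ : L) : K) = 0 at h
    rw [hD₀'L] at h
    exact hj₀ (by exact_mod_cast h)

/-- **Exchange in characteristic zero**, for an arbitrary `C` (reduce to the `ecl`-closed set
`ecl C` by Lemma 3.3: `ecl` is monotone and idempotent). [cite: Kirby2010, Thm. 1.1] -/
theorem ecl_exchange_of_charZero (C : Set K) (a b : K) (hab : a ∈ ecl (insert b C))
    (ha : a ∉ ecl C) : b ∈ ecl (insert a C) := by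
  have h := mem_ecl_insert_of_isEclClosed (isEclClosed_ecl C)
    (ecl_mono (Set.insert_subset_insert (subset_ecl C)) hab) ha
  rwa [ecl_insert_ecl] at h

end Exchange

/-! ### The discharge -/

section Discharge

variable (K : Type*) [Field K] [ExponentialRing K]

/-- **Kirby 2010, Thm. 1.1 HOLDS (exchange): the named fact `Kirby2010_ecl_exchange K` of
`EclPregeometry.lean`** — `a ∈ ecl (C ∪ {b}) ∖ ecl C ⟹ b ∈ ecl (C ∪ {a})` — for every field `K`
with an E-ring structure: in characteristic zero by `ecl_exchange_of_charZero` (Kirby's proof: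
Prop. 7.1 via Lemma 4.8, Cor. 5.2 = Ax 1971 Thm. 3, Thm. 6.3, then Lemma 4.4), and vacuously in
positive characteristic, where `ecl C = K` (`ecl_eq_univ_of_charP`). [cite: Kirby2010, Thm. 1.1] -/
theorem Kirby2010_ecl_exchange_holds : Kirby2010_ecl_exchange K := by
  intro C a b hab ha
  rcases CharP.exists' K with hK | ⟨p, hp, hchar⟩
  · haveI : CharZero K := hK
    exact ecl_exchange_of_charZero C a b hab ha
  · haveI : Fact p.Prime := hp
    haveI : CharP K p := hchar
    rw [ecl_eq_univ_of_charP (p := p) C] at ha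
    exact absurd (Set.mem_univ a) ha

end Discharge

end Literature.NumberTheory.Transcendental
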